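import Summits.BirchSwinnertonDyer.Rank1Residual.F1Sign2.RaisingLawAtTwo
import Summits.BirchSwinnertonDyer.BirchSwinnertonDyer.Theses.ByReductionTypeAtTwo
import Summits.BirchSwinnertonDyer.Rank1Residual.F1Sign2.EggLemmaAtTwoProofs
import Literature.NumberTheory.EllipticCurves.CyclotomicIwasawaMainTheoremIrreducibleBaseChangeProofs
import Literature.NumberTheory.EllipticCurves.RootNumber
import Literature.NumberTheory.QuadraticForms.HilbertSymbol
import HarnessLib.Audit.Tags
import HarnessLib

/-!
# ES-53 (cell `bsd-f1-sign2`, seat `-es` g42): THE FREY–KANI SURFACE OF A CONGRUENT PAIR —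
# egg forcing, the split of the line-coincidence law ES-52E into an off-kernel THEOREM-CANDIDATE and a kernel LAW,
# and the «± object at 2» as the Dokchitser–Maistret / Green–Maistret local constant of the `(2,2)`-isogeny `W × F → Jac C_{W,F}`

Crux workfile (planner seat; nothing here is proposed to `Theorems/`; the typer ports).  Crux `RankOneAtTwoBigImageOddLocal` (stmt-BirchSwinnertonDyer-23715),
route `ByReductionTypeAtTwo`.  MEMO-es §51; census `CensusES53.md` (same directory).  Frames of the ES-51/ES-52 workfiles (`KummerTangentES51.lean` @7baf384fa095,
`RealFlagKummerWindowES52.lean` @eaf649db1fc4) are restated VERBATIM in §0 because `Cruxes/**` modules are not built on the farm.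
PARTITION 52421 = 17880 + 27650 + 3440 + 3451 (unchanged).  Beyond-print theorem: no.  BSD is not proved here.

SETTING (as ES-51/52).  `W` on the 23715 slice with `Ш(W)[2] = 0`, `Δ_W > 0`, `W(ℚ₂)[2] = 0`, generator class `κ(g)` (`g ∉ 2W(ℚ)`); `F` globally minimal of the same conductor,
congruent to `W` mod `2`, `#Sel₂(F) = 1`, odd Tamagawa product («oriented pair»); `V := W[2] = F[2]` via the root correspondence `q ∈ ℚ[X]` (`f_W ∣ f_F ∘ q`);
real 2-division abscissae `e₀<e₁<e₂`, `e'₀<e'₁<e'₂`; flags `A…F` = the permutation `q` induces (`A` = id, `B` = `(e₀ e₁)`, `C`,`D` = `q(e₀) = e'₂`, `E` = `(e₁ e₂)`,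
`F` = the 3-cycle `e₀↦e'₁↦…`); `L_v(E) ⊂ H¹(ℚ_v,V)` the Kummer lines, `e_v := [L_v(W) ≠ L_v(F)]`, `d := e_∞ + e₂ = dim H¹_{L_W+L_F}(ℚ,V)`.

§1 RESULT 1 (finite Poitou–Tate model, es53/enum53.py, 0 violations on 778 + 1598 oriented pairs).  `Q := H¹(ℝ,V) ⊕ H¹(ℚ₂,V)` is a hyperbolic quadratic 4-space
(`n₂(W) = 0`), `loc(H¹(ℚ_{S}/ℚ,V)_{odd-unr})` a Lagrangian `Λ` determined by `κ(g) = (egg·t, ν₂·k_W)`; `L_W := L_∞(W) ⊕ L₂(W)`, `L_F` likewise, `Λ ∩ L_W = ⟨κ⟩`, `Λ ∩ L_F = 0`,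
`β := γ_Wγ_F ∈ Λ`, `L_F` isotropic for `q_F = q_W + ⟨β,·⟩`.  The model FORCES: (a) `g` on the egg whenever `q` moves the largest real root (flags C/D/E/F) — `EggForcedByRealFlagAtTwo`,
census 640/640 (A: 55/61, B: 72/75, so the hypothesis is sharp); (b) `L₂(W) = L₂(F)` in flags C/D whenever `g ∉ 2W(ℚ₂)` — `LineCoincidenceOffKernelAtTwo`, census 448/448;
and leaves EXACTLY ONE free bit: flags C/D with `g ∈ 2W(ℚ₂)` (configurations U3/U4: `β = x_{k'}` resp. `κ + x_{k'}`, `d = 2`), where the census says `e₂ = 0` in 55/55 —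
`LineCoincidenceKernelLawAtTwo`, the whole open content of ES-52E (`(⟹)` of ES-52E is theorem-grade, ES-52 §1).  Kernel glue §2: (b) ∧ (c) ⇒ ES-52E(⟸) with a generator binder.

§3 RESULT 2 — THE ± OBJECT AT 2 (typed in §3).  Let `ψ : W × F → B := (W × F)/Graph(W[2] ≅ F[2])`, `B = Jac C_{W,F}` principally polarised (Howe–Leprévost–Poonen,
arXiv:math/9809210, Prop. 3–4; `ψ` exists iff the pair is not a quadratic-twist pair ⟺ `deg q = 2`; 314/3746 census pairs are twist pairs and are set aside).
Then `Sel^{ψ}(W×F) = H¹_{L_W ∩ L_F}`, `Sel^{ψ̂}(B) = H¹_{L_W+L_F}`, so on an oriented pair `Ш(B)[2^∞] = Ш(B)[ψ̂] ≅ 𝔽₂^{d−1}` and Poonen–Stoll / Dokchitser–Maistret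
(arXiv:1911.04626 Thm. 1.16 «localtoglobal», p.10) give **`d − 1 ≡ N_def(C_{W,F}) (mod 2)`** (`N_def` = number of deficient places) — CENSUS (kit j345121): 2242/2242 oriented,
and `N_def ≡ d` for 1189/1189 pairs of two rank-1 curves.  CONSEQUENCES: (ES-53P, theorem-grade from print) flags B/F ⇒ `Ш(Jac C_{W,F})[2^∞] ≅ ℤ/2`; (ES-53Q ⟺ ES-52E)
flags A/C/D/E and `Δ<0` ⇒ `Ш(Jac C_{W,F})[2^∞] = 0 ⟺ N_def(C_{W,F})` even.
CANONICAL MODEL (ES-53M `GluedSexticModel`, census 3370/3370 + 3376/3376): `C_{W,F} ≅_ℚ {y² = f_W(−q₂x² − s)}`, `q = q₂X²+q₁X+q₀`, `s = −q₁/q₂ + b₂/4`; this is Green–Maistret's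
`y² = f(d x²)` for `f := f_W^{monic}(X − s) = X³+aX²+bX+c` and TWIST CLASS `d := −q₂`: `W ≅ E_f`, `F ≅ Jac(E'_f) ⊗ χ_d` (arXiv:2110.06718 Lemma 2.3, Rem. 2.2).
THE LOCAL IDENTITY (ES-53L `TwistedGreenMaistretAtTwo`, IDENTITY-CANDIDATE; engines Sage + PARI; 0 failures): at every place `v`,
`w_v(W)·w_v(F) = μ_v(C_{W,F}) · (−1)^{n_v(W) − dim(L_v(W) ∩ L_v(F))} · H_v(f) · (d, −c·Δ_W)_v`, `μ_v = −1` iff `C_{W,F}` deficient at `v`, `H_v(f) = (b,−c)_v(−2L,Δ_W)_v(L,−b)_v`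
(`L = ab−9c`; Green–Maistret Def. 2.8; `(−c,−1)_v(2c,Δ_W)_v` if `bL = 0`).  Checks: `v = 2` 6862 (846 with `d ∈ ℚ₂^{×2}` = Green–Maistret Thm 2.11 + Def 1.11 verbatim, 6016 twisted);
`v` odd 28114 (`p ∣ N` 14636, extra primes of the sextic 1712, primes of `b·c·L·Δ·d` 11766; exponent 0 by the S-lemma); `v = ∞` 6862 (Δ>0: reproduces `e_∞ = d − e₂`; Δ<0: exponent 1).
WITHOUT the twist factor `(d,−cΔ_W)_v` the formula fails off `d ∈ ℚ_v^{×2}`.  HENCE, at `v = 2` with `n₂(W) = 0` (`dim(L₂W ∩ L₂F) = 1 − e₂`):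
**`(−1)^{e₂} = − w₂(W)·w₂(F)·μ₂(C_{W,F})·H₂(f)·(−q₂, −cΔ_W)₂`** — the Kummer-line discrepancy at 2 IS the (twisted) Green–Maistret local sign of the Frey–Kani isogeny, uniformly in the
reduction type; ES-52E ⟺ «that product is `−1` exactly in flags C/D» on oriented pairs.  2-parity (Dokchitser–Dokchitser / Monsky) recovers only the PS constraint, so the kernel law
ES-53C (55 pairs) remains the open global residue.  Print placement: Green–Maistret treat `d = 1` locally and reach general congruent pairs GLOBALLY via quadratic-twist invariance of
2-parity (their §7); DGKM arXiv:2211.06357 (Ex. 5, Conj. 1) and Konstantinou arXiv:2311.02137 (Ex. 3, Thm 2) give parity-level local EXPRESSIONS for `y² = g(x²)`, not the place-by-place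
comparison with `w_v(W)w_v(F)`; Morgan arXiv:2409.08034 treats odd semistable `p`.  So ES-53L off `d ∈ ℚ₂^{×2}` is a beyond-print CANDIDATE identity (refuter -ref2 to place).
ES-53L♮ (EQUIVALENT LITERATURE-FACING FORM, v1.1; algebra: `H(ĝ) = H(f)·(d,−Δ)_v` for `ĝ = d⁻³f(dX)`, census 6862/6862 in this form too): for a separable cubic
`g = g₃X³+g₂X²+g₁X+g₀` over a local field with `g₀g₃ ≠ 0`, `C_g : y² = g(x²)`, `E_g : y² = g(x)`, `E'_g : y² = x·g(x)`, the Green–Maistret local theorem should read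
**`w(E_g)·w(Jac E'_g) = λ_{C_g} · H_{ĝ} · (g₃, g₀)_v`**, `ĝ := g/g₃` — the whole effect of a non-monic leading coefficient is the single Hilbert symbol `(lc g, g(0))_v`, symmetric under the
involution `x ↦ 1/x` of `C_g` that swaps `E_g ↔ E'_g` and `g₃ ↔ g₀`.  Dictionary: `g = f_W^{monic}(−q₂X − s)` (so `C_{W,F} = C_g`, `E_g = W`, `Jac E'_g = F`), `g₃ = −q₂³`, `g₀ = c`;
the F-presentation is the reversed one and its twist class is `d_F ≡ c_W` (3431/3431).  Print (g monic in one of the two presentations ⟺ `d_W ∈ K^{×2}` or `d_F ∈ K^{×2}`) covers 801 of the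
3431 census pairs at `v = 2`; 2630 pairs lie outside both presentations' print case.
RG53 (v1.2, kit j345234, CensusES53 §9): on 3200 DISTINCT RANDOM non-monic integer cubics (irreducible over ℚ₂; 58 (Kodaira, Kodaira') pairs over {I₀,I₀*,I₁*,II,II*,III,III*,IV,IV*}², f₂ ∈ {0,2,3,4,5,6},
v₂(disc) ≤ 42) the ♮-identity holds 3200/3200, the symbol `(g₃,g₀)₂` being load-bearing on 1214 of them; with the census: 10062 instances at v = 2, 0 failures.
RG53b (v1.3, kit j345287, CensusES53 §10) — THE GENERAL EXPONENT: dropping the irreducibility-at-2 restriction (`n₂ := dim E_g(ℚ₂)[2] ∈ {0,1,2}`, Kummer images of dim `1+n₂`, exponent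
`n₂ − dim(L_W ∩ L_F)` = `dim ker φ(ℚ₂) − dim coker φ(ℚ₂)` rigorously, since `0 → G → A[2] → A[2]/G → 0` splits and `i_*δ_φ(B(K)) = im δ₂ ∩ Δ(H)`): 3200/3200 random cubics (n₂ = 0: 641, 1: 1659,
2: 900), 0 failures, all Kodaira types incl. multiplicative `I_n`, `I_n*` (542 (n₂,Kod,Kod') triples, f₂ ≤ 8), symbol load-bearing 1367/1367, 410275 PARI-vs-residue-table square-class
cross-checks.  GRAND TOTAL at v = 2: 13262 instances, 0 failures.  INFORMAL GENERAL FORM (ES-53L♮⁺, not typed here — the typed decls keep `NoTwoAdicTwoTorsion`): for every separable cubic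
`g` over `ℚ₂` with `g(0) ≠ 0`, `w(E_g)w(Jac E'_g) = μ(C_g)·(−1)^{dim ker φ(ℚ₂) − dim coker φ(ℚ₂)}·H(ĝ)·(lc g, g(0))₂`, i.e. Green–Maistret's `λ_{ĝ}·𝓔` verbatim with `f := ĝ` and the one extra symbol.
-/

noncomputable section

open scoped Classical
open WeierstrassCurve Polynomial
open Literature.NumberTheory.EllipticCurves Literature.NumberTheory.EllipticCurves.ModularForms
open Summit.BirchSwinnertonDyer.Rank1Residual.F1Sign2 (LocallyTwoPowDivisible ShaTwoTrivial OnEgg MeetsEgg)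
open Literature.NumberTheory.QuadraticForms (hilbertSymbol)

set_option linter.dupNamespace false
set_option autoImplicit false

namespace Summit.BirchSwinnertonDyer.BirchSwinnertonDyer.Cruxes.RankOneAtTwoBigImageOddLocal.ES53

/-! ## §0 Frames restated VERBATIM from `RealFlagKummerWindowES52.lean` @eaf649db1fc4 (`ES53.X` ≡ `ES52.X` syntactically for
`X ∈ {CongruentModTwo, NoTwoAdicTwoTorsion, twoDivPoly, LinesCoincideAtTwoVia}`). -/

/-- `CongruentModTwo W F` (ES-51 §1, verbatim): `a_p(W) ≡ a_p(F) (mod 2)` at every prime `p ∤ 2·N_W·N_F`. -/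
def CongruentModTwo (W F : WeierstrassCurve ℚ) [W.IsGloballyMinimal] [F.IsGloballyMinimal] : Prop :=
  ∀ p : ℕ, p.Prime → ¬ ((p : ℤ) ∣ 2 * (W.conductorNorm ℤ : ℤ) * (F.conductorNorm ℤ : ℤ)) →
    Even (W.frobeniusTrace p - F.frobeniusTrace p)

/-- `NoTwoAdicTwoTorsion W` (ES-51 §1, verbatim): `W(ℚ₂)[2] = 0`. -/
def NoTwoAdicTwoTorsion (W : WeierstrassCurve ℚ) : Prop :=
  ∀ x : ℚ_[2], ((W.map (algebraMap ℚ ℚ_[2])).twoTorsionPolynomial).toPoly.eval x ≠ 0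

/-- The 2-division polynomial `4X³ + b₂X² + 2b₄X + b₆ ∈ ℚ[X]` of `W` (ES-52 §1, verbatim). -/
def twoDivPoly (W : WeierstrassCurve ℚ) : Polynomial ℚ := W.twoTorsionPolynomial.toPoly

/-- `LinesCoincideAtTwoVia W F q` (ES-52 §1, verbatim): `L₂(W) ⊆ L₂(F)` transported by `q` inside `K₂^×/K₂^{×2}`, `K₂ = ℚ₂[T]/(f_W)` (equal dimensions make it `=`). -/
def LinesCoincideAtTwoVia (W F : WeierstrassCurve ℚ) (q : Polynomial ℚ) : Prop :=
  ∀ x y : ℚ_[2], (W.map (algebraMap ℚ ℚ_[2])).toAffine.Nonsingular x y →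
    ∃ x' y' : ℚ_[2], (F.map (algebraMap ℚ ℚ_[2])).toAffine.Nonsingular x' y' ∧
      ∃ u : AdjoinRoot ((twoDivPoly W).map (algebraMap ℚ ℚ_[2])), IsUnit u ∧
        algebraMap ℚ_[2] (AdjoinRoot ((twoDivPoly W).map (algebraMap ℚ ℚ_[2]))) x
            - AdjoinRoot.root ((twoDivPoly W).map (algebraMap ℚ ℚ_[2]))
          = u ^ 2 * (algebraMap ℚ_[2] (AdjoinRoot ((twoDivPoly W).map (algebraMap ℚ ℚ_[2]))) x'
            - AdjoinRoot.mk ((twoDivPoly W).map (algebraMap ℚ ℚ_[2])) (q.map (algebraMap ℚ ℚ_[2])))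

/-! ## §1 ES-53 — what the finite Poitou–Tate model forces, and the one bit it leaves -/

/-- **ES-53A `EggForcedByRealFlagAtTwo` (THEOREM-CANDIDATE; census 640/640).**  Oriented frame of ES-52E (`W` on the 23715 slice, `Ш(W)[2] = 0`, `Δ_W > 0`, `W(ℚ₂)[2] = 0`;
`F` globally minimal, same conductor, congruent mod `2`, `#Sel₂(F) = 1`, odd Tamagawa product; `q`, `e`, `e'` the root correspondence and the ordered real roots).
IF `q` MOVES THE LARGEST REAL ROOT (`q(e₂) ≠ e'₂`, i.e. flag `∈ {C,D,E,F}`) THEN `W(ℚ)` MEETS THE EGG (`W(ℚ) ⊄ W⁰(ℝ)`).  Census (E52 ∪ K51D, N < 10⁴, oriented, `Δ_W>0`,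
`n₂(W)=0`): C 238/238, D 265/265, E 89/89, F 48/48; control: A 55/61, B 72/75 meet the egg, so the hypothesis is sharp.  MECHANISM (es53/enum53.py): in the
finite model the Lagrangian `Λ ∋ β` with `β_∞ = (class of the permutation)` and `Λ ∩ L_F = 0` admit `κ_∞ = 0` only for the permutations fixing `e₂`.  Why it might fail: only if the
S-lemma (`L_p(W) = L_p(F)` at odd `p` under odd Tamagawa numbers) failed; theorem-grade.  Cheapest falsifier: one oriented flag-C/D/E/F pair with `W(ℚ) ⊂ W⁰(ℝ)`. -/
def EggForcedByRealFlagAtTwo : Prop :=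
  ∀ (W : WeierstrassCurve ℚ) [W.IsElliptic] [W.IsGloballyMinimal],
    ¬ W.HasCM → (∀ k : ℕ, W.HasSurjectiveModNGaloisRep ((2 ^ k : ℕ) : ℤ)) → Odd W.torsionOrder → Odd W.tamagawaProduct →
    W.analyticRank = 1 → ShaTwoTrivial W → 0 < W.Δ → NoTwoAdicTwoTorsion W →
    ∀ (F : WeierstrassCurve ℚ) [F.IsElliptic] [F.IsGloballyMinimal],
      F.conductorNorm ℤ = W.conductorNorm ℤ → CongruentModTwo W F → Nat.card (F.selmerGroup (2 : ℤ)) = 1 → Odd F.tamagawaProduct →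
      ∀ (q : Polynomial ℚ) (e e' : Fin 3 → ℝ), twoDivPoly W ∣ (twoDivPoly F).comp q → StrictMono e → StrictMono e' →
        (∀ j, ((twoDivPoly W).map (algebraMap ℚ ℝ)).eval (e j) = 0) → (∀ j, ((twoDivPoly F).map (algebraMap ℚ ℝ)).eval (e' j) = 0) →
        (q.map (algebraMap ℚ ℝ)).eval (e 2) ≠ e' 2 → MeetsEgg W

/-- **ES-53B `LineCoincidenceOffKernelAtTwo` (THEOREM-CANDIDATE; census 448/448 — the model-forced half of ES-52E(⟸)).**  Same frame, a generator-type point `g ∈ W(ℚ) ∖ 2W(ℚ)`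
with `g ∉ 2W(ℚ₂)` (`κ(g)` has non-zero component at `2`), flag C/D (`q(e₀) = e'₂`).  THEN `L₂(W) = L₂(F)`.  Census: C 215/215 (151 non-twist + 64 twist pairs), D 233/233.
MECHANISM: with `κ₂ ≠ 0` the Lagrangian is `⟨t,k'⟩`, `⟨s,k_W⟩` or the graph `Γ_φ`; `Λ ∩ L_F = 0` and `q_F`-isotropy of `L_F` leave only `L₂(F) = L₂(W)` in flags C/D (enumeration,
0 violations / 2376 pairs).  Why it might fail: as ES-53A (S-lemma); theorem-grade.  Cheapest falsifier: an oriented flag-C/D pair with `g ∉ 2W(ℚ₂)` and `e₂ = 1`. -/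
def LineCoincidenceOffKernelAtTwo : Prop :=
  ∀ (W : WeierstrassCurve ℚ) [W.IsElliptic] [W.IsGloballyMinimal],
    ¬ W.HasCM → (∀ k : ℕ, W.HasSurjectiveModNGaloisRep ((2 ^ k : ℕ) : ℤ)) → Odd W.torsionOrder → Odd W.tamagawaProduct →
    W.analyticRank = 1 → ShaTwoTrivial W → 0 < W.Δ → NoTwoAdicTwoTorsion W →
    ∀ (g : (W.toAffine.baseChange ℚ).Point), (∀ Q : (W.toAffine.baseChange ℚ).Point, 2 • Q ≠ g) → ¬ LocallyTwoPowDivisible W 2 1 g →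
    ∀ (F : WeierstrassCurve ℚ) [F.IsElliptic] [F.IsGloballyMinimal],
      F.conductorNorm ℤ = W.conductorNorm ℤ → CongruentModTwo W F → Nat.card (F.selmerGroup (2 : ℤ)) = 1 → Odd F.tamagawaProduct →
      ∀ (q : Polynomial ℚ) (e e' : Fin 3 → ℝ), twoDivPoly W ∣ (twoDivPoly F).comp q → StrictMono e → StrictMono e' →
        (∀ j, ((twoDivPoly W).map (algebraMap ℚ ℝ)).eval (e j) = 0) → (∀ j, ((twoDivPoly F).map (algebraMap ℚ ℝ)).eval (e' j) = 0) →
        (q.map (algebraMap ℚ ℝ)).eval (e 0) = e' 2 → LinesCoincideAtTwoVia W F q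

/-- **ES-53C `LineCoincidenceKernelLawAtTwo` (LAW — the ENTIRE open content of ES-52E; census 55/55: C 23 (13 + 10 twist pairs), D 32).**  Same frame, but `g ∈ 2W(ℚ₂)`
(`κ(g)` vanishes at `2`: the «kernel» case), flag C/D.  THEN `L₂(W) = L₂(F)`.  The finite Poitou–Tate model does NOT force it (configurations U3 `β = x_{k'}` / U4 `β = κ + x_{k'}` with
`d = 2` are consistent with every local and duality constraint); by §3 it is EQUIVALENT to «the Frey–Kani curve `C_{W,F}` is deficient at an even number of places», i.e.
`Ш(Jac C_{W,F})[2^∞] = 0`, for these pairs.  Why it might fail: no parity or duality protects it — a flag-C/D oriented pair with `g ∈ 2W(ℚ₂)` whose relaxed Selmer group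
`H¹_{L_W+L_F}` has the extra class `x_{k'}` (equivalently `N_def(C_{W,F})` odd) kills it; 55 instances is thin.  Sources: census E52/K51D (kit j344946, j344966, j344844),
Poonen–Stoll via arXiv:1911.04626 Thm 1.16, arXiv:2110.06718 Thm 2.11. -/
@[conjecture] def LineCoincidenceKernelLawAtTwo : Prop :=
  ∀ (W : WeierstrassCurve ℚ) [W.IsElliptic] [W.IsGloballyMinimal],
    ¬ W.HasCM → (∀ k : ℕ, W.HasSurjectiveModNGaloisRep ((2 ^ k : ℕ) : ℤ)) → Odd W.torsionOrder → Odd W.tamagawaProduct →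
    W.analyticRank = 1 → ShaTwoTrivial W → 0 < W.Δ → NoTwoAdicTwoTorsion W →
    ∀ (g : (W.toAffine.baseChange ℚ).Point), (∀ Q : (W.toAffine.baseChange ℚ).Point, 2 • Q ≠ g) → LocallyTwoPowDivisible W 2 1 g →
    ∀ (F : WeierstrassCurve ℚ) [F.IsElliptic] [F.IsGloballyMinimal],
      F.conductorNorm ℤ = W.conductorNorm ℤ → CongruentModTwo W F → Nat.card (F.selmerGroup (2 : ℤ)) = 1 → Odd F.tamagawaProduct →
      ∀ (q : Polynomial ℚ) (e e' : Fin 3 → ℝ), twoDivPoly W ∣ (twoDivPoly F).comp q → StrictMono e → StrictMono e' →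
        (∀ j, ((twoDivPoly W).map (algebraMap ℚ ℝ)).eval (e j) = 0) → (∀ j, ((twoDivPoly F).map (algebraMap ℚ ℝ)).eval (e' j) = 0) →
        (q.map (algebraMap ℚ ℝ)).eval (e 0) = e' 2 → LinesCoincideAtTwoVia W F q

/-! ## §2 Kernel glue (pure logic, kernel-checked): ES-53B ∧ ES-53C ⇒ ES-52E(⟸) in the generator-binder form. -/

/-- ES-52E(⟸) with an explicit generator-type binder (`g ∈ W(ℚ) ∖ 2W(ℚ)`; such `g` exists on the slice by Gross–Zagier–Kolyvagin, so this is ES-52E(⟸) itself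
up to that existence): flag C/D ⇒ `L₂(W) = L₂(F)`. -/
def KummerLineCoincidenceIfAtTwo : Prop :=
  ∀ (W : WeierstrassCurve ℚ) [W.IsElliptic] [W.IsGloballyMinimal],
    ¬ W.HasCM → (∀ k : ℕ, W.HasSurjectiveModNGaloisRep ((2 ^ k : ℕ) : ℤ)) → Odd W.torsionOrder → Odd W.tamagawaProduct →
    W.analyticRank = 1 → ShaTwoTrivial W → 0 < W.Δ → NoTwoAdicTwoTorsion W →
    ∀ (g : (W.toAffine.baseChange ℚ).Point), (∀ Q : (W.toAffine.baseChange ℚ).Point, 2 • Q ≠ g) →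
    ∀ (F : WeierstrassCurve ℚ) [F.IsElliptic] [F.IsGloballyMinimal],
      F.conductorNorm ℤ = W.conductorNorm ℤ → CongruentModTwo W F → Nat.card (F.selmerGroup (2 : ℤ)) = 1 → Odd F.tamagawaProduct →
      ∀ (q : Polynomial ℚ) (e e' : Fin 3 → ℝ), twoDivPoly W ∣ (twoDivPoly F).comp q → StrictMono e → StrictMono e' →
        (∀ j, ((twoDivPoly W).map (algebraMap ℚ ℝ)).eval (e j) = 0) → (∀ j, ((twoDivPoly F).map (algebraMap ℚ ℝ)).eval (e' j) = 0) →
        (q.map (algebraMap ℚ ℝ)).eval (e 0) = e' 2 → LinesCoincideAtTwoVia W F q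

/-- KERNEL GLUE: the off-kernel theorem-candidate and the kernel law together give ES-52E(⟸) (case split on `g ∈ 2W(ℚ₂)`). -/
theorem coincidenceIf_of_offKernel_of_kernelLaw (hB : LineCoincidenceOffKernelAtTwo) (hC : LineCoincidenceKernelLawAtTwo) :
    KummerLineCoincidenceIfAtTwo := by
  intro W _ _ hcm hsurj htor htam hrk hsha hdisc hn2 g hg F _ _ hN hcong hsel htamF q e e' hq he he' hre hre' hflag
  by_cases hdiv : LocallyTwoPowDivisible W 2 1 g
  · exact hC W hcm hsurj htor htam hrk hsha hdisc hn2 g hg hdiv F hN hcong hsel htamF q e e' hq he he' hre hre' hflag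
  · exact hB W hcm hsurj htor htam hrk hsha hdisc hn2 g hg hdiv F hN hcong hsel htamF q e e' hq he he' hre hre' hflag

/-- The largest-root hypothesis of ES-53A is implied by the flag-C/D hypothesis of ES-53B/C (a bijection of three ordered roots sending `e₀ ↦ e'₂` cannot fix `e'₂`):
recorded as the elementary real-closed-field fact it is, for `q` inducing an injection on the root sets. -/
theorem top_root_moved_of_flagCD (q : ℝ → ℝ) (e e' : Fin 3 → ℝ) (he : StrictMono e)
    (hinj : Set.InjOn q (Set.range e)) (h0 : q (e 0) = e' 2) : q (e 2) ≠ e' 2 := by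
  intro h2
  have : e 0 = e 2 := by
    have hq : q (e 0) = q (e 2) := by rw [h0, h2]
    exact hinj (Set.mem_range_self 0) (Set.mem_range_self 2) hq
  exact absurd this (ne_of_lt (he (by decide : (0 : Fin 3) < 2)))

/-! ## §3 ES-53L — THE ± OBJECT AT 2: the (twisted) Green–Maistret local constant of the Frey–Kani isogeny `W × F → Jac C_{W,F}`

All quantities below are rational / 2-adic invariants of `(W, F, q)`; `q = q₂X² + q₁X + q₀` is the root correspondence of degree `≤ 2` (`q₂ ≠ 0` ⟺ the pair
is not a quadratic-twist pair).  W-PRESENTATION (Green–Maistret normal form, arXiv:2110.06718 Lemma 2.3 / Remark 2.2): `W ≅ y² = f(x)` with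
`f := f_W^{monic}(X − s)`, `s := −q₁/q₂ + b₂(W)/4`, and `F ≅ Jac(y² = x f(x)) ⊗ χ_d`, `d := −q₂` (the TWIST CLASS of the congruence; `d ∈ ℚ₂^{×2}` ⟺ the pair is
a Green–Maistret pair over `ℚ₂`).  `f = X³ + aX² + bX + c`, `L := ab − 9c` (their Definition 2.8). -/

/-- `s = −q₁/q₂ + b₂/4`: the translation putting `(W, F, q)` in Green–Maistret normal form (`q'(x_c) = 0` at `x_c = (σ₁(f_W)+s)/2`). -/
def gmShift (W : WeierstrassCurve ℚ) (q : Polynomial ℚ) : ℚ := -(q.coeff 1) / (q.coeff 2) + W.b₂ / 4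
/-- `a` of `f = f_W^{monic}(X − s) = X³ + aX² + bX + c` (`f_W^{monic} = X³ + (b₂/4)X² + (b₄/2)X + b₆/4`). -/
def gmA (W : WeierstrassCurve ℚ) (q : Polynomial ℚ) : ℚ := W.b₂ / 4 - 3 * gmShift W q
/-- `b` of `f`. -/
def gmB (W : WeierstrassCurve ℚ) (q : Polynomial ℚ) : ℚ := 3 * (gmShift W q) ^ 2 - 2 * (W.b₂ / 4) * gmShift W q + W.b₄ / 2
/-- `c = f(0) = f_W^{monic}(−s) = −N_{K/ℚ}(θ_W + s)`. -/
def gmC (W : WeierstrassCurve ℚ) (q : Polynomial ℚ) : ℚ := -(gmShift W q) ^ 3 + (W.b₂ / 4) * (gmShift W q) ^ 2 - (W.b₄ / 2) * gmShift W q + W.b₆ / 4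
/-- `L = ab − 9c` (Green–Maistret Definition 2.8). -/
def gmL (W : WeierstrassCurve ℚ) (q : Polynomial ℚ) : ℚ := gmA W q * gmB W q - 9 * gmC W q
/-- The 2-adic Hilbert symbol of two rationals. -/
def hilbTwo (a b : ℚ) : ℤ := hilbertSymbol ℚ_[2] (a : ℚ_[2]) (b : ℚ_[2])
/-- Green–Maistret's local discrepancy `H_{f,ℚ₂} = (b,−c)(−2L,Δ_f)(L,−b)` if `b, L ≠ 0`, else `(−c,−1)(2c,Δ_f)` (Definition 2.8; `Δ_f = Δ_W/16 ≡ Δ_W` mod squares). -/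
def gmHTwo (W : WeierstrassCurve ℚ) (q : Polynomial ℚ) : ℤ :=
  if gmB W q ≠ 0 ∧ gmL W q ≠ 0 then hilbTwo (gmB W q) (-gmC W q) * hilbTwo (-2 * gmL W q) W.Δ * hilbTwo (gmL W q) (-gmB W q)
  else hilbTwo (-gmC W q) (-1) * hilbTwo (2 * gmC W q) W.Δ
/-- THE TWIST CORRECTION `(d, −c·Δ_W)₂`, `d = −q₂` (absent from print: Green–Maistret treat `d = 1`). -/
def twistCorrectionTwo (W : WeierstrassCurve ℚ) (q : Polynomial ℚ) : ℤ := hilbTwo (-(q.coeff 2)) (-(gmC W q) * W.Δ)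
/-- `w₂(E)`: the local root number at `2` (tree: `localRootNumber` over `ℤ₂` of the base change). -/
def rootNumberTwo (E : WeierstrassCurve ℚ) : ℤ := (E.baseChange ℚ_[2]).localRootNumber ℤ_[2]

/-- **THE CANONICAL MODEL** `gluedSextic W q := f_W(−q₂·X² − s)` (`f_W = 4X³ + b₂X² + 2b₄X + b₆`, `s = gmShift W q`): by ES-53M below,
`C_{W,F} ≅_ℚ {y² = f_W(−q₂x² − s)}` — the Green–Maistret curve `y² = f(d x²)` of the W-presentation (census: HLP's sextic `h` satisfies
`x⁶h(1/x) = κ²·f_W(d(tx)² − s)` for 3370/3370 pairs with `b ≠ 0`, and `h(x) = κ²·f_F(d_F(tx)² − s_F)` in the F-presentation 3376/3376). -/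
def gluedSextic (W : WeierstrassCurve ℚ) (q : Polynomial ℚ) : Polynomial ℚ :=
  (twoDivPoly W).comp (Polynomial.C (-(q.coeff 2)) * Polynomial.X ^ 2 - Polynomial.C (gmShift W q))

/-- `IsGluedSexticOf W F q h`: `h ∈ ℚ[X]` is the Howe–Leprévost–Poonen sextic (arXiv:math/9809210 Prop. 4) of the pair glued along `θ_F = q(θ_W)`:
over some field containing the 2-division roots `α_i` of `f_W^{monic}` and `β_i := q(α_i)` of `f_F^{monic}`,
`h = −∏_i (A(α_{i+1}−α_i)(α_i−α_{i−1}) X² + B(β_{i+1}−β_i)(β_i−β_{i−1}))`, `A = Δ_g a₁/a₂`, `B = Δ_f b₁/b₂` (HLP's `a₁,a₂,b₁,b₂`); then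
`Jac(y² = h) ≅ (W × F)/Graph(ψ)` as principally polarised surfaces (HLP Prop. 3–4; `a₁a₂b₁b₂ ≠ 0` iff the pair is not a twist pair). -/
def IsGluedSexticOf (W F : WeierstrassCurve ℚ) (q h : Polynomial ℚ) : Prop :=
  ∃ (K : Type) (_ : Field K) (_ : Algebra ℚ K) (α β : Fin 3 → K),
    Function.Injective α ∧ (∀ i, ((twoDivPoly W).map (algebraMap ℚ K)).eval (α i) = 0) ∧ (∀ i, β i = (q.map (algebraMap ℚ K)).eval (α i)) ∧
    (∀ i, ((twoDivPoly F).map (algebraMap ℚ K)).eval (β i) = 0) ∧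
    let Δf : K := ((α 0 - α 1) * (α 0 - α 2) * (α 1 - α 2)) ^ 2
    let Δg : K := ((β 0 - β 1) * (β 0 - β 2) * (β 1 - β 2)) ^ 2
    let a₁ : K := ∑ i, (α (i - 1) - α (i + 1)) ^ 2 / (β (i - 1) - β (i + 1))
    let a₂ : K := ∑ i, α i * (β (i - 1) - β (i + 1))
    let b₁ : K := ∑ i, (β (i - 1) - β (i + 1)) ^ 2 / (α (i - 1) - α (i + 1))
    let b₂ : K := ∑ i, β i * (α (i - 1) - α (i + 1))
    let A : K := Δg * a₁ / a₂
    let B : K := Δf * b₁ / b₂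
    a₁ ≠ 0 ∧ a₂ ≠ 0 ∧ b₁ ≠ 0 ∧ b₂ ≠ 0 ∧
    h.map (algebraMap ℚ K) = - ∏ i, (Polynomial.C (A * (α (i + 1) - α i) * (α i - α (i - 1))) * Polynomial.X ^ 2 +
                                      Polynomial.C (B * (β (i + 1) - β i) * (β i - β (i - 1))))

/-- **ES-53M `GluedSexticModel` (THEOREM-CANDIDATE, pure algebra in the splitting field; census 3370/3370 + 3376/3376, kit j345121):** the Howe–Leprévost–Poonen sextic of
`(W, F, q)` is, up to `x ↦ 1/(tx)` and a square constant, the canonical model: `x⁶·h(1/x) = κ²·gluedSextic(W,q)(t·x)`.  Hence `C_{W,F} ≅_ℚ {y² = f_W(−q₂x² − s)}`.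
Why it might fail: only the generic case `b·(a₁a₂b₁b₂) ≠ 0` was checked; a degenerate normal form (`b = 0` or `L = 0`, 62 census rows untested) might need a different `t`.
Sources: arXiv:math/9809210 Prop. 4; arXiv:2110.06718 Lemma 2.3. -/
def GluedSexticModel : Prop :=
  ∀ (W F : WeierstrassCurve ℚ) [W.IsElliptic] [F.IsElliptic] (q h : Polynomial ℚ), Irreducible (twoDivPoly W) →
    q.natDegree ≤ 2 → q.coeff 2 ≠ 0 → twoDivPoly W ∣ (twoDivPoly F).comp q → IsGluedSexticOf W F q h →
      ∃ κ t : ℚ, κ ≠ 0 ∧ t ≠ 0 ∧ h.reverse = Polynomial.C (κ ^ 2) * (gluedSextic W q).comp (Polynomial.C t * Polynomial.X)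

/-- `SexticDeficientAtTwo h`: the genus-2 curve `y² = h(x)` (`deg h = 6`) is DEFICIENT at `2` in the sense of Poonen–Stoll: it has no `ℚ₂`-rational divisor of degree `1`,
equivalently (Riemann–Roch) no point over any odd-degree extension `K/ℚ₂` — no affine point and `lc(h) ∉ K^{×2}` (the two points at infinity). -/
def SexticDeficientAtTwo (h : Polynomial ℚ) : Prop :=
  ∀ (K : Type) [Field K] [Algebra ℚ_[2] K] [FiniteDimensional ℚ_[2] K], Odd (Module.finrank ℚ_[2] K) →
    ¬ IsSquare (algebraMap ℚ_[2] K (algebraMap ℚ ℚ_[2] h.leadingCoeff)) ∧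
    ∀ x : K, ¬ IsSquare (((h.map (algebraMap ℚ ℚ_[2])).map (algebraMap ℚ_[2] K)).eval x)

/-- **ES-53L `TwistedGreenMaistretAtTwo` (IDENTITY-CANDIDATE — the ± object at 2; census FK53/RN53, kit j345121 + j345129, engines Sage + PARI/`ellrootno` asserted equal:
v = 2: 3431/3431 non-twist pairs × both presentations; v odd: 14636 checks at p ∣ N, 1712 at extra primes of the sextic, 11766 at primes of b·c·L·Δ·d; v = ∞: 2248 (Δ>0) + 4614 (Δ<0);
0 failures.  The sub-case `−q₂ ∈ ℚ_v^{×2}` is Green–Maistret, arXiv:2110.06718 Thm. 2.11 with Def. 1.11, transported by `dim ker ψ|_v = n_v(W) − n`, `dim coker ψ|_v = dim(L_v(W) ∩ L_v(F))`.)**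
THE LOCAL IDENTITY (all places `v`; typed here at `v = 2` with `n₂(W) = 0`):  `w_v(W)·w_v(F) = μ_v(C_{W,F}) · (−1)^{n_v(W) − dim(L_v(W) ∩ L_v(F))} · H_v(f) · (−q₂, −c·Δ_W)_v`,
where `C_{W,F} : y² = f_W(−q₂x² − s)` (ES-53M), `μ_v = −1` iff `C_{W,F}` is deficient at `v` (Poonen–Stoll), `f = X³+aX²+bX+c = f_W^{monic}(X − s)`, `H_v(f)` = Green–Maistret's
Def. 2.8.  At `v = 2`, `n₂(W) = 0`: `dim(L₂(W) ∩ L₂(F)) = 1 − e₂`, so THE SIGN OF THE KUMMER-LINE DISCREPANCY AT 2 IS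
`(−1)^{e₂(W,F)} = − w₂(W)·w₂(F)·μ₂(C_{W,F})·H₂(f)·(−q₂, −cΔ_W)₂`.
Why it might fail: for `−q₂ ∉ ℚ₂^{×2}` the pair is `(E_f, Jac(E'_f) ⊗ χ_{−q₂})` and no local formula for the twisted pair is in print; the correction `(−q₂,−cΔ_W)₂` is an empirical law
(N < 10⁴, `n₂(W) = 0`; 6016 of the 6862 (pair, presentation) checks have `−q₂ ∉ ℚ₂^{×2}`, 846 are the print case) — an unsampled 2-adic configuration could break it.  Sources: arXiv:2110.06718 (Thm 2.11, Def 1.11, Def 2.8, Lemma 2.3, §7),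
arXiv:1911.04626 (Thm 1.16 / `thm:localtoglobal`), arXiv:math/9809210 (Prop 3–4); census FK53 (kit j345121), RN53 (kit j345129). -/
@[conjecture] def TwistedGreenMaistretAtTwo : Prop :=
  ∀ (W F : WeierstrassCurve ℚ) [W.IsElliptic] [F.IsElliptic], NoTwoAdicTwoTorsion W →
    ∀ (q : Polynomial ℚ), q.natDegree ≤ 2 → q.coeff 2 ≠ 0 → twoDivPoly W ∣ (twoDivPoly F).comp q →
      rootNumberTwo W * rootNumberTwo F =
        (if SexticDeficientAtTwo (gluedSextic W q) then -1 else 1) * (if LinesCoincideAtTwoVia W F q then -1 else 1) * gmHTwo W q * twistCorrectionTwo W q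

/-- **ES-53L′ `GreenMaistretAtTwo` (the PRINT case — support / THEOREM-CANDIDATE; census 846/846):** ES-53L restricted to `−q₂ ∈ ℚ₂^{×2}`, where the twist correction is `1`;
this is arXiv:2110.06718 Thm 2.11 (`K = ℚ₂`, `E = W` in Green–Maistret normal form `y² = f(x)`, `E' ≅ F` over `ℚ₂`, `C : y² = f(x²) ≅ C_{W,F}` over `ℚ₂`) combined with
`λ_{C/ℚ₂} = μ₂(C)·(−1)^{dim ker ψ|₂ − dim coker ψ|₂}` (Def 1.11) and the Kummer-line identification of `coker(W(ℚ₂)/2 × F(ℚ₂)/2 → B(ℚ₂)/ψ̂)`. -/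
def GreenMaistretAtTwo : Prop :=
  ∀ (W F : WeierstrassCurve ℚ) [W.IsElliptic] [F.IsElliptic], NoTwoAdicTwoTorsion W →
    ∀ (q : Polynomial ℚ), q.natDegree ≤ 2 → q.coeff 2 ≠ 0 → IsSquare (-(q.coeff 2 : ℚ_[2])) → twoDivPoly W ∣ (twoDivPoly F).comp q →
      rootNumberTwo W * rootNumberTwo F =
        (if SexticDeficientAtTwo (gluedSextic W q) then -1 else 1) * (if LinesCoincideAtTwoVia W F q then -1 else 1) * gmHTwo W q

/-- Glue: ES-53L ⇒ ES-53L′ (on `−q₂ ∈ ℚ₂^{×2}` the Hilbert symbol `(−q₂, ·)₂` is `1`). Stated as a Prop-level implication modulo the symbol fact `hsq`. -/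
theorem greenMaistret_of_twisted
    (hsq : ∀ (a b : ℚ), IsSquare (a : ℚ_[2]) → a ≠ 0 → b ≠ 0 → hilbTwo a b = 1)
    (hc : ∀ (W : WeierstrassCurve ℚ) (q : Polynomial ℚ), W.IsElliptic → NoTwoAdicTwoTorsion W → -(gmC W q) * W.Δ ≠ 0)
    (h : TwistedGreenMaistretAtTwo) : GreenMaistretAtTwo := by
  intro W F _ _ hW q hq hq2 hsqd hdvd
  have key := h W F hW q hq hq2 hdvd
  have h1 : twistCorrectionTwo W q = 1 := by
    unfold twistCorrectionTwo
    refine hsq _ _ ?_ (neg_ne_zero.mpr hq2) (hc W q ‹_› hW)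
    simpa using hsqd
  rw [key, h1, mul_one]

/-! ### §3♮ (v1.1; BC7 `GreenMaistretNonMonicAtTwo` VERDICT: CLEAN, all batteries, bc7_probe3.out) ES-53L♮ — the literature-facing form: Green–Maistret's local theorem for a NON-MONIC cubic `g`, discrepancy `H(ĝ)·(lc g, g(0))₂`
Dictionary verified on the census (exact arithmetic, 3431/3431): for `g := f_W^{monic}(−q₂X − s) = g₃X³+g₂X²+g₁X+g₀`, `E_g : y² = g(x) ≅ ⟨0,g₂,0,g₁g₃,g₀g₃²⟩ ≅_ℚ W`,
`Jac(E'_g : y² = xg(x)) ≅ ⟨0,g₁,0,g₀g₂,g₀²g₃⟩ ≅_ℚ F`, `C_g : y² = g(x²) = C_{W,F}`, root correspondence `β = g₀g₃/α`, i.e. `q_g = −g₃⁻¹(X² + g₂X + g₁g₃)` (twist class `−q₂ = g₃⁻¹ ≡ g₃`). -/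

/-- `E_g : y² = g(x)` in Weierstrass form (`x ↦ g₃x`): `⟨0, g₂, 0, g₁g₃, g₀g₃²⟩`. -/
def cubicCurve (g₃ g₂ g₁ g₀ : ℚ) : WeierstrassCurve ℚ := ⟨0, g₂, 0, g₁ * g₃, g₀ * g₃ ^ 2⟩
/-- `Jac(E'_g)`, `E'_g : y² = x·g(x)` (send `(0,0)` to infinity): `⟨0, g₁, 0, g₀g₂, g₀²g₃⟩` (for monic `g = X³+aX²+bX+c`: `y² = x³ + bx² + acx + c²`). -/
def shadowCurve (g₃ g₂ g₁ g₀ : ℚ) : WeierstrassCurve ℚ := ⟨0, g₁, 0, g₀ * g₂, g₀ ^ 2 * g₃⟩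
/-- The root correspondence `E_g[2] → Jac(E'_g)[2]`, `α ↦ g₀g₃/α = −g₃⁻¹(α² + g₂α + g₁g₃)`. -/
def shadowCorrespondence (g₃ g₂ g₁ : ℚ) : Polynomial ℚ :=
  -(Polynomial.C g₃⁻¹ * (Polynomial.X ^ 2 + Polynomial.C g₂ * Polynomial.X + Polynomial.C (g₁ * g₃)))
/-- `C_g : y² = g(x²)`. -/
def biellipticSextic (g₃ g₂ g₁ g₀ : ℚ) : Polynomial ℚ :=
  Polynomial.C g₃ * Polynomial.X ^ 6 + Polynomial.C g₂ * Polynomial.X ^ 4 + Polynomial.C g₁ * Polynomial.X ^ 2 + Polynomial.C g₀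
/-- `H₂(ĝ)` for `ĝ = g/g₃ = X³ + âX² + b̂X + ĉ` (Green–Maistret Def. 2.8 at `ℚ₂`; `Δ_ĝ ≡ Δ(E_g)` mod squares). -/
def gmHTwoOfCubic (g₃ g₂ g₁ g₀ : ℚ) : ℤ :=
  let b : ℚ := g₁ / g₃
  let c : ℚ := g₀ / g₃
  let L : ℚ := (g₂ / g₃) * b - 9 * c
  let Δ : ℚ := (cubicCurve g₃ g₂ g₁ g₀).Δ
  if b ≠ 0 ∧ L ≠ 0 then hilbTwo b (-c) * hilbTwo (-2 * L) Δ * hilbTwo L (-b) else hilbTwo (-c) (-1) * hilbTwo (2 * c) Δ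

/-- **ES-53L♮ `GreenMaistretNonMonicAtTwo` (IDENTITY-CANDIDATE, equivalent to ES-53L by `H(ĝ) = H(f)(d,−Δ)₂`, `(g₃,g₀)₂(d,−Δ)₂… = (d,−cΔ)₂`; census 6862/6862 in this form):**
for every separable cubic `g = g₃X³+g₂X²+g₁X+g₀ ∈ ℚ[X]` with `g₀g₃ ≠ 0` and `g` irreducible over `ℚ₂` (`E_g(ℚ₂)[2] = 0`),
`w₂(E_g)·w₂(Jac E'_g) = μ₂(C_g)·(−1)^{1+e₂}·H₂(ĝ)·(g₃, g₀)₂`.  For `g₃ = 1` this is Green–Maistret arXiv:2110.06718 Thm 2.11 (with Def 1.11 and the coker identification); the factor `(lc g, g(0))₂`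
is invariant under the involution `x ↦ 1/x` of `C_g` (which swaps `E_g ↔ Jac E'_g`, `g₃ ↔ g₀`).  Why it might fail: as ES-53L.  Sources: as ES-53L. -/
@[conjecture] def GreenMaistretNonMonicAtTwo : Prop :=
  ∀ (g₃ g₂ g₁ g₀ : ℚ), g₃ ≠ 0 → g₀ ≠ 0 → (cubicCurve g₃ g₂ g₁ g₀).Δ ≠ 0 → NoTwoAdicTwoTorsion (cubicCurve g₃ g₂ g₁ g₀) →
    rootNumberTwo (cubicCurve g₃ g₂ g₁ g₀) * rootNumberTwo (shadowCurve g₃ g₂ g₁ g₀) =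
      (if SexticDeficientAtTwo (biellipticSextic g₃ g₂ g₁ g₀) then -1 else 1) *
      (if LinesCoincideAtTwoVia (cubicCurve g₃ g₂ g₁ g₀) (shadowCurve g₃ g₂ g₁ g₀) (shadowCorrespondence g₃ g₂ g₁) then -1 else 1) *
      gmHTwoOfCubic g₃ g₂ g₁ g₀ * hilbTwo g₃ g₀

/-! ### §3♮′ (v1.4) ES-53L♮ AT AN ODD PRIME — the same identity at every `p ≠ 2`, typed in the locally-irreducible case (`E_g(ℚ_p)[2] = 0`, where the Kummer images are trivial
and Green–Maistret's exponent `dim ker − dim coker` vanishes): `w_p(E_g)·w_p(Jac E'_g) = μ_p(C_g)·H_p(ĝ)·(g₃, g₀)_p`.  Witness: census (odd `p ∣ N`, 28114 checks incl. the symbol) and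
RG53v (kit j345324, CensusES53 §11 @6741ebb3d477: 2560 random cubics × every place `v ∈ {∞,2} ∪ {p ∣ g₀g₃·disc g, p ≤ 3000}`, general exponent `n_v − dim(L_W∩L_F)`: 12883/12883 cells, 0 failures —
∞ 2560, v=2 2557, odd 7766 (p = 3: 1665 incl. wild conductor exponents 3,4,5), symbol load-bearing 3134, odd `n_p = 0` cells 535; BC7 of the decl below: VERDICT CLEAN, bc7_probe4.out).  The frames below are the `p`-adic copies of the
`2`-adic ones above (same text with `ℚ_[p]`, `ℤ_[p]`). -/

/-- `(a,b)_p`. -/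
def hilbAt (p : ℕ) [Fact p.Prime] (a b : ℚ) : ℤ := hilbertSymbol ℚ_[p] (a : ℚ_[p]) (b : ℚ_[p])

/-- `w_p(E)`: the local root number at `p`. -/
def rootNumberAt (p : ℕ) [Fact p.Prime] (E : WeierstrassCurve ℚ) : ℤ := (E.baseChange ℚ_[p]).localRootNumber ℤ_[p]

/-- `E(ℚ_p)[2] = 0`: the 2-division cubic has no root in `ℚ_p`. -/
def NoPadicTwoTorsion (p : ℕ) [Fact p.Prime] (W : WeierstrassCurve ℚ) : Prop :=
  ∀ x : ℚ_[p], ((W.map (algebraMap ℚ ℚ_[p])).twoTorsionPolynomial).toPoly.eval x ≠ 0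

/-- `y² = h(x)` (`deg h = 6`) is deficient at `p` (Poonen–Stoll): no point over any odd-degree extension of `ℚ_p`, affine or at infinity. -/
def SexticDeficientAt (p : ℕ) [Fact p.Prime] (h : Polynomial ℚ) : Prop :=
  ∀ (K : Type) [Field K] [Algebra ℚ_[p] K] [FiniteDimensional ℚ_[p] K], Odd (Module.finrank ℚ_[p] K) →
    ¬ IsSquare (algebraMap ℚ_[p] K (algebraMap ℚ ℚ_[p] h.leadingCoeff)) ∧
    ∀ x : K, ¬ IsSquare (((h.map (algebraMap ℚ ℚ_[p])).map (algebraMap ℚ_[p] K)).eval x)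

/-- Green–Maistret's `H` (arXiv:2110.06718 Def. 2.8) of the monic cubic `ĝ = X³ + (g₂/g₃)X² + (g₁/g₃)X + g₀/g₃` at the prime `p`. -/
def gmHOfCubicAt (p : ℕ) [Fact p.Prime] (g₃ g₂ g₁ g₀ : ℚ) : ℤ :=
  let b : ℚ := g₁ / g₃
  let c : ℚ := g₀ / g₃
  let L : ℚ := (g₂ / g₃) * b - 9 * c
  let Δ : ℚ := (cubicCurve g₃ g₂ g₁ g₀).Δ
  if b ≠ 0 ∧ L ≠ 0 then hilbAt p b (-c) * hilbAt p (-2 * L) Δ * hilbAt p L (-b) else hilbAt p (-c) (-1) * hilbAt p (2 * c) Δ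

/-- **ES-53L♮ₚ `GreenMaistretNonMonicOddPrime` (IDENTITY-CANDIDATE at odd primes, locally irreducible case):** for every prime `p ≠ 2` and every separable cubic
`g = g₃X³+g₂X²+g₁X+g₀ ∈ ℚ[X]` with `g₀g₃ ≠ 0` and no root in `ℚ_p`,  `w_p(E_g)·w_p(Jac E'_g) = μ_p(C_g)·H_p(ĝ)·(g₃, g₀)_p`  (`E_g = cubicCurve`, `Jac E'_g = shadowCurve`,
`C_g : y² = g(x²)`).  For `g₃ ∈ ℚ_p^{×2}` this is Green–Maistret Thm. 2.11 (with `dim ker ψ = dim coker ψ = 0`); the symbol `(g₃,g₀)_p` is the beyond-print part.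
Why it might fail: a wild prime `p = 3` with additive potentially good reduction of `E_g` where `H_p` was only tested on the census' conductors; the deficiency engine at `p = 3`.
Cheapest falsifier: RG53v rows with `n_p = 0` (kit j345324). -/
@[conjecture] def GreenMaistretNonMonicOddPrime : Prop :=
  ∀ (p : ℕ) [Fact p.Prime], p ≠ 2 → ∀ (g₃ g₂ g₁ g₀ : ℚ), g₃ ≠ 0 → g₀ ≠ 0 → (cubicCurve g₃ g₂ g₁ g₀).Δ ≠ 0 →
    NoPadicTwoTorsion p (cubicCurve g₃ g₂ g₁ g₀) →
      rootNumberAt p (cubicCurve g₃ g₂ g₁ g₀) * rootNumberAt p (shadowCurve g₃ g₂ g₁ g₀)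
        = (if SexticDeficientAt p (biellipticSextic g₃ g₂ g₁ g₀) then -1 else 1) * gmHOfCubicAt p g₃ g₂ g₁ g₀ * hilbAt p g₃ g₀

/-- The `p`-adic frames specialise to the `2`-adic ones (definitional). -/
theorem hilbAt_two (a b : ℚ) : hilbAt 2 a b = hilbTwo a b := rfl

theorem rootNumberAt_two (E : WeierstrassCurve ℚ) : rootNumberAt 2 E = rootNumberTwo E := rfl

/-! ### §3β (v1.5) THE THETA-DISCREPANCY CLASS IS THE BRANCH CLASS (lemma, exact algebra; RG53t kit j345375, CensusES53 §12)
ES-52 measured the shift between the two quadratic refinements on `H = H¹(ℚ_v, W[2])` as `q_F = q_W + ⟨β,·⟩`, `β = γ_W·γ_F`, `γ_E = −disc(f_E)·f_E'(T_E)`.  In the `g`-normalisation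
(`f_W = X³+g₂X²+g₁g₃X+g₀g₃²`, `f_F = X³+g₁X²+g₀g₂X+g₀²g₃`, `q(T) = −(T²+g₂T+g₁g₃)/g₃`) the EXACT identity `T·f_F'(q(T)) ≡ −g₀·f_W'(T) (mod f_W)` holds (below, typed; checked on 40 random
parameter sets), hence modulo squares **`β ≡ −g₀·T ≡ c_W·(0 − T)`: β is the Kummer class of the point `(0, g₃)` of the twist `W^{(c_W)} : c_W·y² = f_W(x)` (`c_W = f_W(0) = g₀g₃²`), i.e. of the
BRANCH DIVISOR of the Frey–Kani double cover `C_{W,F} → W` (the two points of `W` above `u = 0` of `y² = g(u)`, conjugate over `ℚ(√g₀)`); symmetrically `β = ` the class of `(0, ĝ₀)` on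
Green–Maistret's `E' = F^{(g₃)}`.**  Numerically (RG53t, v = 2, 2400 random cubics with `g₃ ∉ ℚ₂^{×2}`): `β = δ_{F^{(g₃)}}(P₀)` 2400/2400 and `β = δ_{W^{(g₀)}}(Q₀)` 2400/2400.
CONSEQUENCES CHECKED THERE (all 2400/2400): Kramer–Tunnell `w(E)w(E^{(d)}) = (d, −Δ_E)₂(−1)^{κ(E,d)}` with `κ(E,d) = codim_{L_E}(L_E ∩ L_{E^{(d)}})` for `E ∈ {W,F}`, `d = g₃`; Green–Maistret IN PRINT
for the monic `ĝ` (pair = `(W^{(d)}, F^{(d)})`); ES-53L♮; and therefore the TWISTING LAW `κ(W,d)+κ(F,d)+dim(L_W∩L_F)+dim(L_{W^d}∩L_{F^d}) ≡ [μ(C)≠μ(C^{(d)})]+[(d,g₀)₂=−1]`.  LAGRANGIAN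
BOOKKEEPING (plan (b′)): `q_{E^{(d)}} = q_E`, `β ∈ L_{F^{(d)}}` always (it is `δ(P₀)`), so `L_W, L_{W^d}, L_{F^d}` are `q_W`-Lagrangian and `L_F` is iff `β ∈ L_F`; observed: `β = 0` ⇒ parity 0
(243/243, hence `μ(C)μ(C^{(d)}) = (d, g₀)₂` there); `β ∈ L_W ∪ L_F` ⇒ parity 0 (1225/1225, as the two-families rule predicts after replacing `L_F` by `(L_F ∩ β^⊥) + ⟨β⟩`); parity 1 only with
`β ∉ L_W ∪ L_F` (887 of 1175 such rows).  So ES-53L♮ ⟺ a formula for the deficiency ratio `μ(C)μ(C^{(lc g)})` of the bielliptic curve `y² = g(x²)` under the quadratic twist by its leading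
coefficient, in terms of the position of the branch class `β` relative to `L_W`, `L_F` — the -es proof plan of record for P-es-53♮.
v1.6 (kit j345401, CensusES53 §12b @48ae682cf157): with the pairing `⟨a,b⟩ = ∏_{P∣2}(a,b)_{K_P}` and `L̃_F := (L_F ∩ β^⊥) + ⟨β⟩` the two-families rule for `(L_W, L̃_F, L_{W^{(d)}}, L_{F^{(d)}})` holds
in 2400/2400 rows and predicts the observed parity exactly (2400/2400): `κ_W+κ_F+i+i_d ≡ π := [β∉L_F] + dim(L_W∩L_F) + dim(L_W∩L̃_F)`.  HENCE, modulo Green–Maistret-in-print and Kramer–Tunnell,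
`GreenMaistretNonMonicAtTwo` ⟺ **`μ₂(C_g)·μ₂(C_g^{(lc g)}) = (lc g, g(0))₂·(−1)^{π}`** (deficiency ratio of the bielliptic curve under the leading-coefficient twist; no root numbers).
v1.7 (literature, Morgan arXiv:1504.01960): Morgan's Conjecture 1 — «Let `K` be a local field of characteristic zero, `L/K` a quadratic extension, `C/K` a hyperelliptic curve, and `J` its
Jacobian. Then `w(J/K)w(J^L/K) = ((−1)^g Δ_C, L/K)·i_d(C)·i_d(C^L)·(−1)^{dim_𝔽₂ J(K)/N J(L)}`» — HOLDS for `J = Jac C_g` over `ℚ_v` (`C_g/ℚ`): by his Theorem 4 («if the 2-parity conjecture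
holds for `J/F` over every quadratic extension `F/K`, then (Kramer–Tunnell) holds for `J/K_{v₀}` and every quadratic extension `L/K_{v₀}`»), since `J ~ W × F` over `ℚ` and 2-parity for
`W/F`, `F/F` (F/ℚ quadratic) is Kramer + Dokchitser–Dokchitser arXiv:0906.1815.  With the exact identity `disc(g(x²)) = −64·lc(g)·g(0)·disc(g)²` (so `Δ_{C_g} ≡ −lc(g)·g(0)`, and the
symbols cancel: `(g₃,g₀)(dg₃,dg₀)(−g₃g₀,d) = 1`), Kramer–Tunnell for `W, F` and Mazur–Rubin's `J(K)/N J(L) = X_J/(X_J ∩ X_{J^L})` (`X` = Kummer image in `H¹(K,J[2])`, maximal isotropic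
for the Poonen–Rains form; Morgan Lemma 14), the beyond-print identity takes its FINAL REDUCED FORM — no root numbers, no deficiency, no Hilbert symbol:
**ES-53♮-lag: `dim(X_J ∩ X_{J^{(d)}}) + dim(L_W ∩ L_F) + dim(L_{W^{(d)}} ∩ L_{F^{(d)}}) ≡ dim_𝔽₂ J(ℚ_v)[2] (mod 2)`, `d = lc g`, `J = Jac(y² = g(x²))`** — equivalently
`dim J(ℚ_v)/N J(ℚ_v(√d)) ≡ dim coker φ(ℚ_v) + dim coker φ^{(d)}(ℚ_v)` for the (2,2)-gluing `φ : W × F → J` and its twist (GM♮(g) ∧ GM♮(dg) ⟺ this, for every `d`, given the print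
theorems; `d = lc g` makes GM♮(dg) the monic print case).  Three intersections of maximal isotropic subspaces (two in `(H¹(ℚ_v,W[2]), q_W)`, one in `(H¹(ℚ_v,J[2]), q_J)`) and the rational
2-torsion of the Frey–Kani Jacobian: a pure Poonen–Rains / Klagsbrun–Mazur–Rubin linear-algebra target (plan (c)); numerically it is IMPLIED on the 2400 RG53t rows by the verified twisting
law + the print theorems, not independently tested (needs a genus-2 local Kummer-image engine: D-es-53e). -/

/-! ### §3λ (v1.8) THE LINEAR-ALGEBRA CORE OF THE PROOF SKETCH (`ProofSketchES53Lag.md` @59a9a29ae953), typed over Mathlib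
ES-53L♮ ⇐ print (GM Thm 2.11, Kramer–Tunnell/DD, Morgan arXiv:1504.01960 Conj 1 via Thm 4) + the Lagrangian lemma `dim J(K)/NJ(K(√d)) ≡ dim coker φ(K) + dim coker φ^{(d)}(K)`,
whose only non-bookkeeping ingredient beyond Poonen–Rains (Prop 4.8/4.10 for `𝓛 = φ̂^*M`; `ker φ̂` a level subgroup ⇒ `im H¹(K, ker φ̂)` Lagrangian) and Mazur–Rubin is the
Klagsbrun–Mazur–Rubin two-families rule in the three-Lagrangian form below (support, pure Mathlib, size S/M: maximal totally singular subspaces of a hyperbolic `𝔽₂`-quadratic space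
fall into two families with `dim(L ∩ L') ≡ ½dim V` iff same family; summing over the three pairs gives the stated parity).  Applied with `V = H¹(K,J[2])`, `L₁ = X_J`, `L₂ = X_{J^{(d)}}`,
`L₃ = ker φ̂_*` (`dim(X_J ∩ ker φ̂_*) = ½dim V − dim(L_W ∩ L_F)`, same with `d`) it yields ES-53♮-lag `dim(X_J∩X_{J^{(d)}}) + dim(L_W∩L_F) + dim(L_{W^{(d)}}∩L_{F^{(d)}}) ≡ dim J(K)[2]`. -/

/-- A `Q`-Lagrangian of an `𝔽₂`-quadratic space: totally singular (`Q = 0` on it) of half dimension. -/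
def IsQLagrangian {V : Type} [AddCommGroup V] [Module (ZMod 2) V]
    (Q : QuadraticForm (ZMod 2) V) (L : Submodule (ZMod 2) V) : Prop :=
  (∀ x ∈ L, Q x = 0) ∧ 2 * Module.finrank (ZMod 2) L = Module.finrank (ZMod 2) V

/-- support (S/M, pure Mathlib; Klagsbrun–Mazur–Rubin MR3043582, the «two families» of maximal totally singular subspaces): for three `Q`-Lagrangians of a finite-dimensional
`𝔽₂`-quadratic space with nondegenerate polar form, `dim(L₁∩L₂) + dim(L₁∩L₃) + dim(L₂∩L₃) + ½dim V` is even.  The load-bearing linear algebra of ES-53♮-lag. -/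
def ThreeLagrangianParity : Prop :=
  ∀ (V : Type) [AddCommGroup V] [Module (ZMod 2) V] [FiniteDimensional (ZMod 2) V]
    (Q : QuadraticForm (ZMod 2) V),
    (QuadraticMap.polarBilin Q).Nondegenerate →
    ∀ (L₁ L₂ L₃ : Submodule (ZMod 2) V),
      IsQLagrangian Q L₁ → IsQLagrangian Q L₂ → IsQLagrangian Q L₃ →
      Even (Module.finrank (ZMod 2) ↥(L₁ ⊓ L₂) + Module.finrank (ZMod 2) ↥(L₁ ⊓ L₃)
            + Module.finrank (ZMod 2) ↥(L₂ ⊓ L₃) + Module.finrank (ZMod 2) V / 2)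

/-- `f_W` of the `g`-normalisation as a polynomial: `X³ + g₂X² + g₁g₃X + g₀g₃²` (the 2-division cubic of `cubicCurve`). -/
def cubicPolyW (g₃ g₂ g₁ g₀ : ℚ) : Polynomial ℚ :=
  Polynomial.X ^ 3 + Polynomial.C g₂ * Polynomial.X ^ 2 + Polynomial.C (g₁ * g₃) * Polynomial.X + Polynomial.C (g₀ * g₃ ^ 2)

/-- `f_F`: `X³ + g₁X² + g₀g₂X + g₀²g₃` (the 2-division cubic of `shadowCurve`). -/
def cubicPolyF (g₃ g₂ g₁ g₀ : ℚ) : Polynomial ℚ :=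
  Polynomial.X ^ 3 + Polynomial.C g₁ * Polynomial.X ^ 2 + Polynomial.C (g₀ * g₂) * Polynomial.X + Polynomial.C (g₀ ^ 2 * g₃)

/-- **ES-53β `BranchClassIdentity` (support, exact polynomial identity ⇒ `β ≡ −g₀·T`):** `X · f_F'(q(X)) + g₀ · f_W'(X) ≡ 0 (mod f_W)` for the shadow correspondence `q`.
Why it might fail: it cannot modulo a slip in the normalisation (40/40 random exact checks); filed so that a prover lands it (`Polynomial.modByMonic` computation) and ES-52's `β` acquires
its geometric meaning (branch divisor of `C → W`). -/
def BranchClassIdentity : Prop :=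
  ∀ (g₃ g₂ g₁ g₀ : ℚ), g₃ ≠ 0 →
    (Polynomial.X * (Polynomial.derivative (cubicPolyF g₃ g₂ g₁ g₀)).comp (shadowCorrespondence g₃ g₂ g₁)
        + Polynomial.C g₀ * Polynomial.derivative (cubicPolyW g₃ g₂ g₁ g₀)) %ₘ (cubicPolyW g₃ g₂ g₁ g₀) = 0

end Summit.BirchSwinnertonDyer.BirchSwinnertonDyer.Cruxes.RankOneAtTwoBigImageOddLocal.ES53
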